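/-
Copyright (c) 2026 the pub-hodgecm-mathlib formalisation cell (harness21).  Prover seat hodgecm-mathlib-K2E1-p11 (g5), Track B ∕ K2-LIT, h413 = `stmt-HodgeConjecture-24833`,
R90-TF section S8 «ContSpec-n½», the `hCONT` letter of the (R)′ road — of record AND in ESTATE T's currency (S8 dealer R90-CS-plan (g3); R90 bus 2026-09-05T02:21:36Z (iii), F3):
THE `hCONT` ROWS FROM THE PER-GENERATOR EXPORTS-WITH-(E6) ALONE — `T := 1`, `S := ∅`, NO pole-ledger letter, NO Maass–Selberg letter — because the truncated `L²` family of the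
exports extends holomorphically across every candidate pole of the GENERATOR's slit plane (★ p864577 `truncatedFamily_removable_on_of_rows`, letter-free).
-/
import Summits.HodgeConjecture.HodgeConjecture.Theorems.R90S8ResGMidRowsOfTauExportsU3                                   -- ★ p864446 (this seat): `rowsE4Ebd_slit_of_exports`, the τ vocabulary; brings ★ p863205 (`midContinuation_quotientSubgroup_mul`, `eqOn_of_isPreconnected_of_eqOn_re_gt`), ★ `isPreconnected_convex_diff_of_countable`
import Summits.HodgeConjecture.HodgeConjecture.Theorems.K2E1ChiTruncatedFamilyRemovableFreeCMThree                        -- ★ p864577 (this seat): `truncatedFamily_removable_on_of_rows` (letter-free localised pole-set shrink)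
import Summits.HodgeConjecture.HodgeConjecture.Theorems.K2E1ChiEisensteinMeromorphicExportsKFiniteWithTruncatedFamilyCMThree  -- ★ p864592 (this seat): the K-finite exports head WITH (E6), hypothesis-first on the gauge letters
import HarnessLib

/-!
# R90-TF · S8 «ContSpec-n½» — `R90S8ResGMidHContRowsFreeU3`: THE `hCONT` ROWS OF (R)′ — OF RECORD AND AT τ-ADMISSIBLE GENERATORS — FROM THE PER-GENERATOR EXPORTS WITH (E6) ALONE

Track B ∕ K2-LIT, crux h413 = `stmt-HodgeConjecture-24833`, route of record `HCCMUnconditional`; cell `hodgecm-mathlib`, R90-TF programme, section S8, sub-socket (R)′ (★ p863731 of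
record, binder `hCONT` :293–:311; ★ p864188 in ESTATE T's currency, binder `hCONT` :77–:89).  THEOREMS ONLY (no `def`, no `instance`, no `notation`, no named-fact hypothesis, no `sorry`;
default heartbeats); lane `--supports stmt-HodgeConjecture-24833 --as helper` (count-neutral).  CLOSES NO SOCKET.

WHY THE LEDGER LETTER DISAPPEARS ([MoeglinWaldspurger1995, IV.1.9–IV.1.11, IV.2.3]; [BernsteinLapid2019, Thm 2.3, §4]; [Conway1978, IV §3, V §1]).  ★ (C4) `hCONT_of_truncatedFamily_exports`
(K2E1-p10) derived one generator's `hCONT` from the exports' (E6) family `Fam` (holomorphic OFF the candidate pole set `P`) and a LEDGER letter `hPS : P ∩ {1<Re} ⊆ S` (`S` finite real)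
— a letter that the engine's `P` (all candidate poles, removable or not) cannot satisfy as printed.  But a GENERATOR of the residual block comes with its own continuation `Ec`, holomorphic
on the slit plane `D := {1<Re} ∖ Sp` (`Sp` finite real — generator datum `hEd`); by ★ p864446 §1 the exports transfer (E4)+(E2-bd) to `Ec` on ALL of `D`; ★ p863205 gives left-`G(F)`-
invariance on `D`; and on `D ∖ P` the identity theorem gives `Ec = Ec′`, so `Fam z =ᵐ quotFun (Λ^T (Ec z))` there.  ★ p864577 (this seat) then extends `Fam` holomorphically across EVERY point
of `D ∩ P` with the right a.e. value — its `L²` bound near a candidate pole being automatic (Cauchy on squares + Tonelli).  Hence `hCONT` holds with `T := 1` (or any `T ≥ 1`) and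
`S := ∅`: NO ledger, NO (MS-P′).  (The χ pole ledger is still what makes the WITNESS a generator — `Sp = {3∕2}` for `φ₀` — but it is no longer an input of the ∀-rows `hCONT` ∕ `hEXP`.)
* §1 **`hCONT_of_truncatedFamily_exports_free`** — ONE generator (pair section `φ` of `(χ₁, χ₂)`, `χ₂` automorphic; generator datum `Ec Sp hSp hEd hE2`; package `ν 𝓕`; the exports'
  `Ec′ P` with closedness, co-discreteness, `P ⊆ {Re ≤ 2}`, analyticity off `P`, tube, (E4), (E2-bd) off `P`, and (E6) at one level `T ≥ 1`) ⊢ `hCONT`'s conclusion VERBATIM.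
* §2 **`hCONT_row_of_exportsRow_free`**, **`hCONT_admissible_row_of_exportsRow_free`** — ★ `hCONT_row_of_exportsRow` ∕ `hCONT_admissible_row_of_exportsRow` (of record, ED. 1∕2) with the
  exports row `hEXP6` RID OF `S hS hPS` (its clause list is now exactly what ★ `…_with_truncatedFamily` heads print, plus (E4) ∕ (E2-bd)).
* §3 **`hCONT_tauRow_of_truncatedExportsRow`** — ★ p864188's `hCONT` τ-ROW from the per-τ-generator exports-with-(E6) row `hTEXP6` (generic `χ₁ χ₂`).
* §4 **`truncatedExportsTauRow_of_gauge_blocks`**, **`hCONT_tauRow_of_gauge_blocks`** — `hTEXP6`, hence the `hCONT` τ-row, from the BLOCK LETTER `hBLOCK` of ★ p864446 §3 (every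
  τ-admissible generator lies in a finite-dimensional `K_max`-stable block of continuous bounded pair-sections carrying row 1's gauge letters) via ★ p864592; the row's own Heisenberg
  package `(ν, 𝓕)` is fed to the head (`ν` right-invariant because Haar and inversion-invariant).
USE (B ED. 7 ∕ (R)′ τ-assembly): `hCONT := R90.S8.hCONT_tauRow_of_gauge_blocks L μ νG hβ hμZ ξ.hψ hBLOCK` next to ★ `hEXP := R90.S8.hEXP_tauRow_of_gauge_blocks L μ νG ν h𝓕N h𝓕c h𝓕₀ hβ hμZ ξ.hψ hBLOCK`
— the SAME block letter pays both rows.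
HONEST LABEL: HC_CM is proved only modulo the 7 printed citations (2 remaining named inputs: hLiu418 = `stmt-HodgeConjecture-24832`, h413 = `stmt-HodgeConjecture-24833`) until rung 0
closes; REL ≠ ★ ≠ BUILT; (R)′'s `hCONT` row is ★ MODULO the per-generator exports-with-(E6) (of record: ★ at admissible levels; τ: `hBLOCK` = τ-ports (★) + K2E1-p12's laws §5∕§6 (★) at
named blocks); this file closes no socket; count-neutral.

## References
* [MoeglinWaldspurger1995] C. Mœglin, J.-L. Waldspurger, *Spectral Decomposition and Eisenstein Series* (1995), I.2.13, IV.1.9–IV.1.11, IV.2.3, V.3.13.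
* [BernsteinLapid2019] J. Bernstein, E. Lapid, *On the meromorphic continuation of Eisenstein series*, J. Amer. Math. Soc. 37 (2024), Thm 2.3, §4 p. 10.
* [Conway1978] J. B. Conway, *Functions of One Complex Variable I*, 2nd ed. (1978), IV §3 (identity theorem), V §1 (removable singularities).
* [Rogawski1990] J. D. Rogawski, *Automorphic Representations of Unitary Groups in Three Variables* (1990), §13.9 p. 229 (ii).
-/

set_option autoImplicit false
set_option linter.dupNamespace false  -- the mandated namespace `…HodgeConjecture.HodgeConjecture.R90.S8` (LEAD #1 L1) repeats the summit's segment

noncomputable section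

open MeasureTheory Measure NumberField IsDedekindDomain Set Filter Topology
open scoped ENNReal NNReal
open Literature.NumberTheory Literature.NumberTheory.Automorphic Literature.NumberTheory.Automorphic.UnitaryGroup Literature.NumberTheory.GaloisRepresentations AdelicGroupData
open Literature.NumberTheory.Automorphic.Arthur2013.Leaves.TECR Literature.NumberTheory.Rogawski1990 Literature.MeasureTheory.Group
open Summit.HodgeConjecture.HodgeConjecture.Cruxes.H413.K2E1BorelEisensteinU
open Summit.HodgeConjecture.HodgeConjecture.Cruxes.H413.K2E1BLBorelSpacesU2Defs Summit.HodgeConjecture.HodgeConjecture.Cruxes.H413.K2E1BLBorelOperatorsU2Defs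
open Summit.HodgeConjecture.HodgeConjecture.Cruxes.H413.K2E1CharacterEisensteinU3PairDefs Summit.HodgeConjecture.HodgeConjecture.Cruxes.H413.K2E1ChiSectionSpaceU3PairDefs
open Summit.HodgeConjecture.HodgeConjecture.Cruxes.H413.K2E1ConvexDiffCountableConnected (isPreconnected_convex_diff_of_countable countable_of_codiscrete)
open Summit.HodgeConjecture.HodgeConjecture.Cruxes.H413.K2E1ChiTruncatedFamilyRemovableFreeCMThree (truncatedFamily_removable_on_of_rows)
open Summit.HodgeConjecture.HodgeConjecture.Cruxes.H413.K2E1ChiEisensteinMeromorphicExportsKFiniteWithTruncatedFamilyCMThree (chiEisenstein_meromorphic_exports_kfinite_cm_three_of_gauge_letters_with_truncatedFamily)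

namespace Summit.HodgeConjecture.HodgeConjecture.R90.S8

variable (L : Type) [Field L] [NumberField L] [IsCMField L]
  [MeasurableSpace (quasiSplit (↥(maximalRealSubfield L)) L (IsCMField.complexConj L) 3).Adelic] [BorelSpace (quasiSplit (↥(maximalRealSubfield L)) L (IsCMField.complexConj L) 3).Adelic]

/-! ## §1 One generator: `hCONT` from the exports with (E6), no ledger -/

/-- **`hCONT` FOR ONE GENERATOR FROM ITS EXPORTS WITH (E6) — NO LEDGER LETTER, NO `L²` LETTER** (module docstring).  Data: a `(χ₁, χ₂)`-pair section `φ` (`χ₂` automorphic); the generator's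
continuation `Ec` with a finite real `Sp ⊆ (1, 2]`, holomorphic per `g` on `{1 < Re} ∖ Sp` (`hEd`), equal to the series on the tube (`hE2`); a Heisenberg package `(ν, 𝓕)` (Haar,
fundamental domain of compact closure); the exports' `Ec′`, `P` (closed, co-discrete, `⊆ {Re ≤ 2}`; analytic, (E4), (E2-bd) off `P`; tube) and (E6) at a level `T ≥ 1`.  THEN
`∃ T ≥ 1, ∃ S finite real, ∃ Fam : ℂ → L²(μ), DifferentiableOn ℂ Fam ({1<Re} ∖ (Sp ∪ S)) ∧ ∀ z there, Fam z =ᵐ[μ] quotFun (Λ^T (Ec z))` with `S := ∅`: rows (E4)+(E2-bd) for `Ec` on the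
slit plane ★ `rowsE4Ebd_slit_of_exports`, `hEcinv` ★ `midContinuation_quotientSubgroup_mul`, `Ec = Ec′` on the slit plane minus `P` (identity theorem ★ `eqOn_of_isPreconnected_of_eqOn_re_gt`
on the preconnected ★ `isPreconnected_convex_diff_of_countable`), and the letter-free shrink ★ `truncatedFamily_removable_on_of_rows`.
[cite: MoeglinWaldspurger1995, IV.1.9–IV.1.11, IV.2.3] [cite: BernsteinLapid2019, Thm 2.3, §4] [cite: Conway1978, IV §3, V §1] -/
theorem hCONT_of_truncatedFamily_exports_free
    (μ : Measure (quasiSplit (↥(maximalRealSubfield L)) L (IsCMField.complexConj L) 3).automorphicQuotient) [SFinite μ]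
    {χ₁ : HeckeCharacter L} {χ₂ : ↥(TorusDict.torus (IsCMField.complexConj L)) →ₜ* ℂˣ} (hχ₂ : TorusDict.IsAutomorphic (IsCMField.complexConj L) χ₂)
    {φ : (quasiSplit (↥(maximalRealSubfield L)) L (IsCMField.complexConj L) 3).Adelic → ℂ} (hφ : IsChiSectionPair χ₁ χ₂ φ)
    (Ec : ℂ → (quasiSplit (↥(maximalRealSubfield L)) L (IsCMField.complexConj L) 3).Adelic → ℂ) (Sp : Finset ℂ) (hSp : ∀ s ∈ Sp, s.im = 0 ∧ 1 < s.re ∧ s.re ≤ 2)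
    (hEd : ∀ g, DifferentiableOn ℂ (fun z => Ec z g) ({z : ℂ | 1 < z.re} \ (↑Sp : Set ℂ)))
    (hE2 : ∀ z : ℂ, 2 < z.re → Ec z = eisensteinSeriesU (flatSectionU φ z))
    (ν : Measure ↥(adelicUnipotent (↥(maximalRealSubfield L)) L (IsCMField.complexConj L) 3)) [ν.IsHaarMeasure] {𝓕 : Set ↥(adelicUnipotent (↥(maximalRealSubfield L)) L (IsCMField.complexConj L) 3)}
    (h𝓕N : IsFundamentalDomain ↥(rationalUnipotent (↥(maximalRealSubfield L)) L (IsCMField.complexConj L) 3) 𝓕 ν) (h𝓕c : IsCompact (closure 𝓕))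
    -- the exports with (E6) at `φ`
    {Ec' : ℂ → (quasiSplit (↥(maximalRealSubfield L)) L (IsCMField.complexConj L) 3).Adelic → ℂ} {P : Set ℂ} (hPc : IsClosed P) (hPcd : ∀ z₀ : ℂ, ∀ᶠ s in 𝓝[≠] z₀, s ∉ P) (hPre : ∀ z ∈ P, z.re ≤ 2)
    (hEan' : ∀ g (z : ℂ), z ∉ P → AnalyticAt ℂ (fun z => Ec' z g) z) (hE2' : ∀ z : ℂ, 2 < z.re → Ec' z = eisensteinSeriesU (flatSectionU φ z))
    (hE4' : ∀ z : ℂ, z ∉ P → Continuous (Ec' z))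
    (hEbd' : ∀ z₁ : ℂ, z₁ ∉ P → ∀ K : Set (quasiSplit (↥(maximalRealSubfield L)) L (IsCMField.complexConj L) 3).Adelic, IsCompact K → ∃ V ∈ 𝓝 z₁, ∃ M : ℝ, ∀ z ∈ V, ∀ g ∈ K, ‖Ec' z g‖ ≤ M)
    {T : ℝ≥0} (hT : 1 ≤ T)
    (hE6' : ∃ Fam : ℂ → Lp ℂ 2 μ, DifferentiableOn ℂ Fam Pᶜ ∧
      ∀ z : ℂ, z ∉ P → ((Fam z : Lp ℂ 2 μ) : (quasiSplit (↥(maximalRealSubfield L)) L (IsCMField.complexConj L) 3).automorphicQuotient → ℂ) =ᵐ[μ] (quasiSplit (↥(maximalRealSubfield L)) L (IsCMField.complexConj L) 3).quotFun (truncation ν 𝓕 T (Ec' z))) :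
    ∃ (T : ℝ≥0) (_ : 1 ≤ T) (S : Finset ℂ) (_ : ∀ s ∈ S, s.im = 0) (Fam : ℂ → (quasiSplit (↥(maximalRealSubfield L)) L (IsCMField.complexConj L) 3).L2 μ),
      DifferentiableOn ℂ Fam ({z : ℂ | 1 < z.re} \ (↑(Sp ∪ S) : Set ℂ)) ∧
      ∀ z ∈ ({z : ℂ | 1 < z.re} \ (↑(Sp ∪ S) : Set ℂ)), ((Fam z : (quasiSplit (↥(maximalRealSubfield L)) L (IsCMField.complexConj L) 3).L2 μ) : (quasiSplit (↥(maximalRealSubfield L)) L (IsCMField.complexConj L) 3).automorphicQuotient → ℂ) =ᵐ[μ] (quasiSplit (↥(maximalRealSubfield L)) L (IsCMField.complexConj L) 3).quotFun (truncation ν 𝓕 T (Ec z)) := by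
  classical
  set D : Set ℂ := {z : ℂ | 1 < z.re} \ (↑Sp : Set ℂ) with hD
  have hHo : IsOpen {z : ℂ | 1 < z.re} := isOpen_lt continuous_const Complex.continuous_re
  have hDo : IsOpen D := hHo.sdiff Sp.finite_toSet.isClosed
  -- the rows on `D` for the generator's own family: (E4)+(E2-bd) ★ p864446 §1, `hEcinv` ★ p863205
  have hagree : ∀ z : ℂ, 2 < z.re → ∀ g, Ec z g = Ec' z g := fun z hz g => by rw [hE2 z hz, hE2' z hz]
  obtain ⟨hE4, hEbd⟩ := rowsE4Ebd_slit_of_exports L (fun s hs => (hSp s hs).2.2) hEd hagree hPc hPcd hPre hEan' hE4' hEbd'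
  have hEcinv : ∀ z ∈ D, ∀ (γ : (quasiSplit (↥(maximalRealSubfield L)) L (IsCMField.complexConj L) 3).arithmeticSubgroup) (x : (quasiSplit (↥(maximalRealSubfield L)) L (IsCMField.complexConj L) 3).Adelic), Ec z ((γ : (quasiSplit (↥(maximalRealSubfield L)) L (IsCMField.complexConj L) 3).Adelic) * x) = Ec z x := fun z hz γ x =>
    midContinuation_quotientSubgroup_mul L hφ hχ₂ (fun s hs => (hSp s hs).1) hEd hE2 ((quasiSplit (↥(maximalRealSubfield L)) L (IsCMField.complexConj L) 3).arithmeticSubgroup_le_quotientSubgroup γ.2) x hz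
  -- `Ec = Ec′` on `D ∖ P` (identity theorem on the preconnected `{1<Re} ∖ (Sp ∪ P)`, base point `3`)
  have hCo : IsOpen ({z : ℂ | 1 < z.re} \ ((↑Sp : Set ℂ) ∪ P)) := hHo.sdiff (Sp.finite_toSet.isClosed.union hPc)
  have hCc : IsPreconnected ({z : ℂ | 1 < z.re} \ ((↑Sp : Set ℂ) ∪ P)) :=
    isPreconnected_convex_diff_of_countable Literature.Topology.Euclidean.one_lt_rank_real_complex (convex_halfSpace_re_gt 1) hHo
      (Sp.finite_toSet.countable.union (countable_of_codiscrete hPcd))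
  have h3 : (3 : ℂ) ∈ {z : ℂ | 1 < z.re} \ ((↑Sp : Set ℂ) ∪ P) := by
    refine ⟨by show (1 : ℝ) < (3 : ℂ).re; norm_num, fun h => h.elim (fun h => ?_) (fun h => ?_)⟩
    · have h' := (hSp _ h).2.2; norm_num at h'
    · have h' := hPre _ h; norm_num at h'
  have heq : ∀ z ∈ D \ P, Ec z = Ec' z := fun z hz => funext fun g =>
    eqOn_of_isPreconnected_of_eqOn_re_gt (u := fun w => Ec w g) (v := fun w => Ec' w g) (a := 1) (b := 2) (S := (↑Sp : Set ℂ) ∪ P)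
      ((hEd g).mono fun w hw => ⟨hw.1, fun h => hw.2 (Or.inl h)⟩) (fun w hw => (hEan' g w fun h => hw.2 (Or.inr h)).differentiableAt.differentiableWithinAt)
      (hagree · · g) hCo hCc Subset.rfl h3 (by show (2 : ℝ) < (3 : ℂ).re; norm_num) ⟨hz.1.1, fun h => h.elim hz.1.2 hz.2⟩
  -- the exports' family represents `Λ^T (Ec z)` on `D ∖ P`; shrink across `D ∩ P` (★ letter-free)
  obtain ⟨Fam, hFd, hFam⟩ := hE6'
  obtain ⟨Fam', hFd', hFam'⟩ := truncatedFamily_removable_on_of_rows L μ ν h𝓕N h𝓕c hT Ec hPc hPcd hDo hEd hE4 hEbd hEcinv Fam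
    (hFd.mono fun z hz => hz.2) fun z hz => by rw [heq z hz]; exact hFam z hz.2
  refine ⟨T, hT, ∅, fun s hs => absurd hs (Finset.notMem_empty s), Fam', ?_, ?_⟩
  · simpa only [Finset.union_empty] using hFd'
  · simpa only [Finset.union_empty] using hFam'

/-! ## §2 The `hCONT` row OF RECORD from the per-generator exports-with-(E6) row, no ledger -/

/-- **THE `hCONT` ROW OF THE (R)′ OF RECORD FROM ONE PER-GENERATOR EXPORTS ROW — NO LEDGER** (★ `hCONT_row_of_exportsRow`, ED. 1, with `S hS hPS` removed from `hEXP6`): given, for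
every generator datum `(K′, ω, φ)` of the block of `ξ` and every normalised Heisenberg package `(ν, 𝓕)`, the exports' `Ec′, P` with closedness, co-discreteness, `P ⊆ {Re ≤ 2}`, tube,
analyticity ∕ (E4) ∕ (E2-bd) off `P` and (E6) at every `T ≥ 1` (exactly what ★ `chiEisenstein_meromorphic_exports_level_cm_three_with_truncatedFamily` prints), the row `hCONT` holds —
§1 per generator (`T := 1`, `S := ∅`). [cite: MoeglinWaldspurger1995, IV.1.11, IV.2.3, V.3.13] [cite: BernsteinLapid2019, Thm 2.3, §4] [cite: Rogawski1990, §13.9 p. 229 (ii)] -/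
theorem hCONT_row_of_exportsRow_free
    (μ : Measure (quasiSplit (↥(maximalRealSubfield L)) L (IsCMField.complexConj L) 3).automorphicQuotient) [(quasiSplit (↥(maximalRealSubfield L)) L (IsCMField.complexConj L) 3).IsAutomorphicMeasure μ]
    (μω : HeckeCharacter L) (ξ : OneDimAutRepH L)
    (hEXP6 : ∀ (K' : Subgroup (quasiSplit (↥(maximalRealSubfield L)) L (IsCMField.complexConj L) 3).Adelic) (ω : ↥K' →* ℂ)
      (φ : (quasiSplit (↥(maximalRealSubfield L)) L (IsCMField.complexConj L) 3).Adelic → ℂ) (_ : φ ∈ chiSectionSpacePair (ξ.bcη⁻¹ * ξ.bcψ⁻¹ * μω) ξ.ψ K' (ω : ↥K' → ℂ)) (_ : Continuous φ)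
      (ν : Measure ↥(adelicUnipotent (↥(maximalRealSubfield L)) L (IsCMField.complexConj L) 3)) (_ : ν.IsHaarMeasure) (𝓕 : Set ↥(adelicUnipotent (↥(maximalRealSubfield L)) L (IsCMField.complexConj L) 3))
      (_ : IsFundamentalDomain ↥(rationalUnipotent (↥(maximalRealSubfield L)) L (IsCMField.complexConj L) 3) 𝓕 ν) (_ : IsCompact (closure 𝓕)) (_ : ν.IsInvInvariant) (_ : ν 𝓕 = 1),
      ∃ (Ec' : ℂ → (quasiSplit (↥(maximalRealSubfield L)) L (IsCMField.complexConj L) 3).Adelic → ℂ) (P : Set ℂ), IsClosed P ∧ (∀ z₀ : ℂ, ∀ᶠ s in 𝓝[≠] z₀, s ∉ P) ∧ (∀ z ∈ P, z.re ≤ 2) ∧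
        (∀ z : ℂ, 2 < z.re → Ec' z = eisensteinSeriesU (flatSectionU φ z)) ∧ (∀ g (z : ℂ), z ∉ P → AnalyticAt ℂ (fun z => Ec' z g) z) ∧
        (∀ z : ℂ, z ∉ P → Continuous (Ec' z)) ∧
        (∀ z₁ : ℂ, z₁ ∉ P → ∀ K : Set (quasiSplit (↥(maximalRealSubfield L)) L (IsCMField.complexConj L) 3).Adelic, IsCompact K → ∃ V ∈ 𝓝 z₁, ∃ M : ℝ, ∀ z ∈ V, ∀ g ∈ K, ‖Ec' z g‖ ≤ M) ∧
        (∀ T : ℝ≥0, 1 ≤ T → ∃ Fam : ℂ → Lp ℂ 2 μ, DifferentiableOn ℂ Fam Pᶜ ∧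
          ∀ z : ℂ, z ∉ P → ((Fam z : Lp ℂ 2 μ) : (quasiSplit (↥(maximalRealSubfield L)) L (IsCMField.complexConj L) 3).automorphicQuotient → ℂ) =ᵐ[μ] (quasiSplit (↥(maximalRealSubfield L)) L (IsCMField.complexConj L) 3).quotFun (truncation ν 𝓕 T (Ec' z)))) :
    ∀ (K' : Subgroup (quasiSplit (↥(maximalRealSubfield L)) L (IsCMField.complexConj L) 3).Adelic) (ω : ↥K' →* ℂ)
      (φ : (quasiSplit (↥(maximalRealSubfield L)) L (IsCMField.complexConj L) 3).Adelic → ℂ) (_ : φ ∈ chiSectionSpacePair (ξ.bcη⁻¹ * ξ.bcψ⁻¹ * μω) ξ.ψ K' (ω : ↥K' → ℂ)) (_ : Continuous φ)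
      (Ec : ℂ → (quasiSplit (↥(maximalRealSubfield L)) L (IsCMField.complexConj L) 3).Adelic → ℂ) (Sp : Finset ℂ) (_ : ∀ s ∈ Sp, s.im = 0 ∧ 1 < s.re ∧ s.re ≤ 2)
      (_ : ∀ g, DifferentiableOn ℂ (fun z => Ec z g) ({z : ℂ | 1 < z.re} \ (↑Sp : Set ℂ)))
      (_ : ∀ z : ℂ, 2 < z.re → Ec z = eisensteinSeriesU (flatSectionU φ z))
      (Fp : (quasiSplit (↥(maximalRealSubfield L)) L (IsCMField.complexConj L) 3).Adelic → ℂ → ℂ) (_ : ∀ g, AnalyticAt ℂ (Fp g) ((3 : ℂ) / 2))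
      (_ : ∀ g, Fp g =ᶠ[𝓝[≠] ((3 : ℂ) / 2)] fun z => (z - (3 : ℂ) / 2) * Ec z g)
      (f : (quasiSplit (↥(maximalRealSubfield L)) L (IsCMField.complexConj L) 3).L2 μ) (_ : (f : (quasiSplit (↥(maximalRealSubfield L)) L (IsCMField.complexConj L) 3).automorphicQuotient → ℂ) =ᵐ[μ] fun x => Fp (Quotient.out (x : (quasiSplit (↥(maximalRealSubfield L)) L (IsCMField.complexConj L) 3).Adelic ⧸ (quasiSplit (↥(maximalRealSubfield L)) L (IsCMField.complexConj L) 3).quotientSubgroup))⁻¹ ((3 : ℂ) / 2))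
      (ν : Measure ↥(adelicUnipotent (↥(maximalRealSubfield L)) L (IsCMField.complexConj L) 3)) (_ : ν.IsHaarMeasure) (𝓕 : Set ↥(adelicUnipotent (↥(maximalRealSubfield L)) L (IsCMField.complexConj L) 3)) (_ : IsFundamentalDomain ↥(rationalUnipotent (↥(maximalRealSubfield L)) L (IsCMField.complexConj L) 3) 𝓕 ν) (_ : IsCompact (closure 𝓕)) (_ : ν.IsInvInvariant) (_ : ν 𝓕 = 1),
      ∃ (T : ℝ≥0) (_ : 1 ≤ T) (S : Finset ℂ) (_ : ∀ s ∈ S, s.im = 0) (Fam : ℂ → (quasiSplit (↥(maximalRealSubfield L)) L (IsCMField.complexConj L) 3).L2 μ),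
        DifferentiableOn ℂ Fam ({z : ℂ | 1 < z.re} \ (↑(Sp ∪ S) : Set ℂ)) ∧
        ∀ z ∈ ({z : ℂ | 1 < z.re} \ (↑(Sp ∪ S) : Set ℂ)), ((Fam z : (quasiSplit (↥(maximalRealSubfield L)) L (IsCMField.complexConj L) 3).L2 μ) : (quasiSplit (↥(maximalRealSubfield L)) L (IsCMField.complexConj L) 3).automorphicQuotient → ℂ) =ᵐ[μ] (quasiSplit (↥(maximalRealSubfield L)) L (IsCMField.complexConj L) 3).quotFun (truncation ν 𝓕 T (Ec z)) := by
  intro K' ω φ hφ hφc Ec Sp hSp hEd hE2 Fp _hF _hFE f _hf ν hν 𝓕 h𝓕N h𝓕c hνi hν1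
  haveI := hν
  obtain ⟨Ec', P, hPc, hPcd, hPre, hE2', hEan', hE4', hEbd', hE6'⟩ := hEXP6 K' ω φ hφ hφc ν hν 𝓕 h𝓕N h𝓕c hνi hν1
  exact hCONT_of_truncatedFamily_exports_free L μ ξ.hψ (isChiSectionPair_of_mem hφ) Ec Sp hSp hEd hE2 ν h𝓕N h𝓕c hPc hPcd hPre hEan' hE2' hE4' hEbd' le_rfl (hE6' 1 le_rfl)

/-- **ED. 2 — THE `hCONT` ROW OF ★ `res_midBlock_le_residual_of_admissible` FROM THE ADMISSIBLE EXPORTS-WITH-(E6) ROW, NO LEDGER**: §2 with both ∀-rows restricted to the generator data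
satisfying an admissibility predicate `Adm`. [cite: MoeglinWaldspurger1995, IV.1.11, IV.2.3, V.3.13] [cite: BernsteinLapid2019, Thm 2.3, §4] [cite: Rogawski1990, §13.9 p. 229 (ii)] -/
theorem hCONT_admissible_row_of_exportsRow_free
    (μ : Measure (quasiSplit (↥(maximalRealSubfield L)) L (IsCMField.complexConj L) 3).automorphicQuotient) [(quasiSplit (↥(maximalRealSubfield L)) L (IsCMField.complexConj L) 3).IsAutomorphicMeasure μ]
    (μω : HeckeCharacter L) (ξ : OneDimAutRepH L)
    (Adm : ∀ K' : Subgroup (quasiSplit (↥(maximalRealSubfield L)) L (IsCMField.complexConj L) 3).Adelic, (↥K' →* ℂ) → ((quasiSplit (↥(maximalRealSubfield L)) L (IsCMField.complexConj L) 3).Adelic → ℂ) → Prop)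
    (hEXP6 : ∀ (K' : Subgroup (quasiSplit (↥(maximalRealSubfield L)) L (IsCMField.complexConj L) 3).Adelic) (ω : ↥K' →* ℂ)
      (φ : (quasiSplit (↥(maximalRealSubfield L)) L (IsCMField.complexConj L) 3).Adelic → ℂ) (_ : Adm K' ω φ) (_ : φ ∈ chiSectionSpacePair (ξ.bcη⁻¹ * ξ.bcψ⁻¹ * μω) ξ.ψ K' (ω : ↥K' → ℂ)) (_ : Continuous φ)
      (ν : Measure ↥(adelicUnipotent (↥(maximalRealSubfield L)) L (IsCMField.complexConj L) 3)) (_ : ν.IsHaarMeasure) (𝓕 : Set ↥(adelicUnipotent (↥(maximalRealSubfield L)) L (IsCMField.complexConj L) 3))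
      (_ : IsFundamentalDomain ↥(rationalUnipotent (↥(maximalRealSubfield L)) L (IsCMField.complexConj L) 3) 𝓕 ν) (_ : IsCompact (closure 𝓕)) (_ : ν.IsInvInvariant) (_ : ν 𝓕 = 1),
      ∃ (Ec' : ℂ → (quasiSplit (↥(maximalRealSubfield L)) L (IsCMField.complexConj L) 3).Adelic → ℂ) (P : Set ℂ), IsClosed P ∧ (∀ z₀ : ℂ, ∀ᶠ s in 𝓝[≠] z₀, s ∉ P) ∧ (∀ z ∈ P, z.re ≤ 2) ∧
        (∀ z : ℂ, 2 < z.re → Ec' z = eisensteinSeriesU (flatSectionU φ z)) ∧ (∀ g (z : ℂ), z ∉ P → AnalyticAt ℂ (fun z => Ec' z g) z) ∧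
        (∀ z : ℂ, z ∉ P → Continuous (Ec' z)) ∧
        (∀ z₁ : ℂ, z₁ ∉ P → ∀ K : Set (quasiSplit (↥(maximalRealSubfield L)) L (IsCMField.complexConj L) 3).Adelic, IsCompact K → ∃ V ∈ 𝓝 z₁, ∃ M : ℝ, ∀ z ∈ V, ∀ g ∈ K, ‖Ec' z g‖ ≤ M) ∧
        (∀ T : ℝ≥0, 1 ≤ T → ∃ Fam : ℂ → Lp ℂ 2 μ, DifferentiableOn ℂ Fam Pᶜ ∧
          ∀ z : ℂ, z ∉ P → ((Fam z : Lp ℂ 2 μ) : (quasiSplit (↥(maximalRealSubfield L)) L (IsCMField.complexConj L) 3).automorphicQuotient → ℂ) =ᵐ[μ] (quasiSplit (↥(maximalRealSubfield L)) L (IsCMField.complexConj L) 3).quotFun (truncation ν 𝓕 T (Ec' z)))) :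
    ∀ (K' : Subgroup (quasiSplit (↥(maximalRealSubfield L)) L (IsCMField.complexConj L) 3).Adelic) (ω : ↥K' →* ℂ)
      (φ : (quasiSplit (↥(maximalRealSubfield L)) L (IsCMField.complexConj L) 3).Adelic → ℂ) (_ : Adm K' ω φ) (_ : φ ∈ chiSectionSpacePair (ξ.bcη⁻¹ * ξ.bcψ⁻¹ * μω) ξ.ψ K' (ω : ↥K' → ℂ)) (_ : Continuous φ)
      (Ec : ℂ → (quasiSplit (↥(maximalRealSubfield L)) L (IsCMField.complexConj L) 3).Adelic → ℂ) (Sp : Finset ℂ) (_ : ∀ s ∈ Sp, s.im = 0 ∧ 1 < s.re ∧ s.re ≤ 2)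
      (_ : ∀ g, DifferentiableOn ℂ (fun z => Ec z g) ({z : ℂ | 1 < z.re} \ (↑Sp : Set ℂ)))
      (_ : ∀ z : ℂ, 2 < z.re → Ec z = eisensteinSeriesU (flatSectionU φ z))
      (Fp : (quasiSplit (↥(maximalRealSubfield L)) L (IsCMField.complexConj L) 3).Adelic → ℂ → ℂ) (_ : ∀ g, AnalyticAt ℂ (Fp g) ((3 : ℂ) / 2))
      (_ : ∀ g, Fp g =ᶠ[𝓝[≠] ((3 : ℂ) / 2)] fun z => (z - (3 : ℂ) / 2) * Ec z g)
      (f : (quasiSplit (↥(maximalRealSubfield L)) L (IsCMField.complexConj L) 3).L2 μ) (_ : (f : (quasiSplit (↥(maximalRealSubfield L)) L (IsCMField.complexConj L) 3).automorphicQuotient → ℂ) =ᵐ[μ] fun x => Fp (Quotient.out (x : (quasiSplit (↥(maximalRealSubfield L)) L (IsCMField.complexConj L) 3).Adelic ⧸ (quasiSplit (↥(maximalRealSubfield L)) L (IsCMField.complexConj L) 3).quotientSubgroup))⁻¹ ((3 : ℂ) / 2))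
      (ν : Measure ↥(adelicUnipotent (↥(maximalRealSubfield L)) L (IsCMField.complexConj L) 3)) (_ : ν.IsHaarMeasure) (𝓕 : Set ↥(adelicUnipotent (↥(maximalRealSubfield L)) L (IsCMField.complexConj L) 3)) (_ : IsFundamentalDomain ↥(rationalUnipotent (↥(maximalRealSubfield L)) L (IsCMField.complexConj L) 3) 𝓕 ν) (_ : IsCompact (closure 𝓕)) (_ : ν.IsInvInvariant) (_ : ν 𝓕 = 1),
      ∃ (T : ℝ≥0) (_ : 1 ≤ T) (S : Finset ℂ) (_ : ∀ s ∈ S, s.im = 0) (Fam : ℂ → (quasiSplit (↥(maximalRealSubfield L)) L (IsCMField.complexConj L) 3).L2 μ),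
        DifferentiableOn ℂ Fam ({z : ℂ | 1 < z.re} \ (↑(Sp ∪ S) : Set ℂ)) ∧
        ∀ z ∈ ({z : ℂ | 1 < z.re} \ (↑(Sp ∪ S) : Set ℂ)), ((Fam z : (quasiSplit (↥(maximalRealSubfield L)) L (IsCMField.complexConj L) 3).L2 μ) : (quasiSplit (↥(maximalRealSubfield L)) L (IsCMField.complexConj L) 3).automorphicQuotient → ℂ) =ᵐ[μ] (quasiSplit (↥(maximalRealSubfield L)) L (IsCMField.complexConj L) 3).quotFun (truncation ν 𝓕 T (Ec z)) := by
  intro K' ω φ hAdm hφ hφc Ec Sp hSp hEd hE2 Fp _hF _hFE f _hf ν hν 𝓕 h𝓕N h𝓕c hνi hν1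
  haveI := hν
  obtain ⟨Ec', P, hPc, hPcd, hPre, hE2', hEan', hE4', hEbd', hE6'⟩ := hEXP6 K' ω φ hAdm hφ hφc ν hν 𝓕 h𝓕N h𝓕c hνi hν1
  exact hCONT_of_truncatedFamily_exports_free L μ ξ.hψ (isChiSectionPair_of_mem hφ) Ec Sp hSp hEd hE2 ν h𝓕N h𝓕c hPc hPcd hPre hEan' hE2' hE4' hEbd' le_rfl (hE6' 1 le_rfl)

/-! ## §3 ESTATE T's currency: ★ p864188's `hCONT` τ-row from the per-τ-generator exports-with-(E6) row -/

/-- **THE `hCONT` τ-ROW OF ★ p864188 `res_midBlock_le_residual_of_tauAdmissible` FROM THE PER-GENERATOR EXPORTS-WITH-(E6) ROW `hTEXP6`** (generic `(χ₁, χ₂)`, `χ₂` automorphic; at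
`χ₁ := ξ.bcη⁻¹·ξ.bcψ⁻¹·μω`, `χ₂ := ξ.ψ` the conclusion is ★ p864188's binder `hCONT` :77–:89 VERBATIM): per τ-admissible generator §1 (`T := 1`, `S := ∅`).
[cite: MoeglinWaldspurger1995, IV.1.11, IV.2.3, V.3.13] [cite: BernsteinLapid2019, Thm 2.3, §4] [cite: Rogawski1990, §13.9 p. 229 (ii)] -/
theorem hCONT_tauRow_of_truncatedExportsRow
    (μ : Measure (quasiSplit (↥(maximalRealSubfield L)) L (IsCMField.complexConj L) 3).automorphicQuotient) [(quasiSplit (↥(maximalRealSubfield L)) L (IsCMField.complexConj L) 3).IsAutomorphicMeasure μ]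
    {χ₁ : HeckeCharacter L} {χ₂ : ↥(TorusDict.torus (IsCMField.complexConj L)) →ₜ* ℂˣ} (hχ₂ : TorusDict.IsAutomorphic (IsCMField.complexConj L) χ₂)
    (hTEXP6 : ∀ (U₀ : Subgroup ↥(finAdelic (↥(maximalRealSubfield L)) L (IsCMField.complexConj L) 3 ((StdForm.antidiagonal 3).over L))) (_ : IsTauLevel L U₀)
      (φ : (quasiSplit (↥(maximalRealSubfield L)) L (IsCMField.complexConj L) 3).Adelic → ℂ) (_ : φ ∈ chiSectionSpacePair χ₁ χ₂ (tauLevel L U₀) ((1 : ↥(tauLevel L U₀) →* ℂ) : ↥(tauLevel L U₀) → ℂ)) (_ : Continuous φ)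
      (_ : IsArchFinite L φ)
      (ν : Measure ↥(adelicUnipotent (↥(maximalRealSubfield L)) L (IsCMField.complexConj L) 3)) (_ : ν.IsHaarMeasure) (𝓕 : Set ↥(adelicUnipotent (↥(maximalRealSubfield L)) L (IsCMField.complexConj L) 3))
      (_ : IsFundamentalDomain ↥(rationalUnipotent (↥(maximalRealSubfield L)) L (IsCMField.complexConj L) 3) 𝓕 ν) (_ : IsCompact (closure 𝓕)) (_ : ν.IsInvInvariant) (_ : ν 𝓕 = 1),
      ∃ (Ec' : ℂ → (quasiSplit (↥(maximalRealSubfield L)) L (IsCMField.complexConj L) 3).Adelic → ℂ) (P : Set ℂ), IsClosed P ∧ (∀ z₀ : ℂ, ∀ᶠ s in 𝓝[≠] z₀, s ∉ P) ∧ (∀ z ∈ P, z.re ≤ 2) ∧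
        (∀ z : ℂ, 2 < z.re → Ec' z = eisensteinSeriesU (flatSectionU φ z)) ∧ (∀ g (z : ℂ), z ∉ P → AnalyticAt ℂ (fun z => Ec' z g) z) ∧
        (∀ z : ℂ, z ∉ P → Continuous (Ec' z)) ∧
        (∀ z₁ : ℂ, z₁ ∉ P → ∀ K : Set (quasiSplit (↥(maximalRealSubfield L)) L (IsCMField.complexConj L) 3).Adelic, IsCompact K → ∃ V ∈ 𝓝 z₁, ∃ M : ℝ, ∀ z ∈ V, ∀ g ∈ K, ‖Ec' z g‖ ≤ M) ∧
        (∀ T : ℝ≥0, 1 ≤ T → ∃ Fam : ℂ → Lp ℂ 2 μ, DifferentiableOn ℂ Fam Pᶜ ∧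
          ∀ z : ℂ, z ∉ P → ((Fam z : Lp ℂ 2 μ) : (quasiSplit (↥(maximalRealSubfield L)) L (IsCMField.complexConj L) 3).automorphicQuotient → ℂ) =ᵐ[μ] (quasiSplit (↥(maximalRealSubfield L)) L (IsCMField.complexConj L) 3).quotFun (truncation ν 𝓕 T (Ec' z)))) :
    ∀ (U₀ : Subgroup ↥(finAdelic (↥(maximalRealSubfield L)) L (IsCMField.complexConj L) 3 ((StdForm.antidiagonal 3).over L))) (_ : IsTauLevel L U₀)
      (φ : (quasiSplit (↥(maximalRealSubfield L)) L (IsCMField.complexConj L) 3).Adelic → ℂ) (_ : φ ∈ chiSectionSpacePair χ₁ χ₂ (tauLevel L U₀) ((1 : ↥(tauLevel L U₀) →* ℂ) : ↥(tauLevel L U₀) → ℂ)) (_ : Continuous φ)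
      (_ : IsArchFinite L φ)
      (Ec : ℂ → (quasiSplit (↥(maximalRealSubfield L)) L (IsCMField.complexConj L) 3).Adelic → ℂ) (Sp : Finset ℂ) (_ : ∀ s ∈ Sp, s.im = 0 ∧ 1 < s.re ∧ s.re ≤ 2)
      (_ : ∀ g, DifferentiableOn ℂ (fun z => Ec z g) ({z : ℂ | 1 < z.re} \ (↑Sp : Set ℂ)))
      (_ : ∀ z : ℂ, 2 < z.re → Ec z = eisensteinSeriesU (flatSectionU φ z))
      (Fp : (quasiSplit (↥(maximalRealSubfield L)) L (IsCMField.complexConj L) 3).Adelic → ℂ → ℂ) (_ : ∀ g, AnalyticAt ℂ (Fp g) ((3 : ℂ) / 2))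
      (_ : ∀ g, Fp g =ᶠ[𝓝[≠] ((3 : ℂ) / 2)] fun z => (z - (3 : ℂ) / 2) * Ec z g)
      (f : (quasiSplit (↥(maximalRealSubfield L)) L (IsCMField.complexConj L) 3).L2 μ) (_ : (f : (quasiSplit (↥(maximalRealSubfield L)) L (IsCMField.complexConj L) 3).automorphicQuotient → ℂ) =ᵐ[μ] fun x => Fp (Quotient.out (x : (quasiSplit (↥(maximalRealSubfield L)) L (IsCMField.complexConj L) 3).Adelic ⧸ (quasiSplit (↥(maximalRealSubfield L)) L (IsCMField.complexConj L) 3).quotientSubgroup))⁻¹ ((3 : ℂ) / 2))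
      (ν : Measure ↥(adelicUnipotent (↥(maximalRealSubfield L)) L (IsCMField.complexConj L) 3)) (_ : ν.IsHaarMeasure) (𝓕 : Set ↥(adelicUnipotent (↥(maximalRealSubfield L)) L (IsCMField.complexConj L) 3)) (_ : IsFundamentalDomain ↥(rationalUnipotent (↥(maximalRealSubfield L)) L (IsCMField.complexConj L) 3) 𝓕 ν) (_ : IsCompact (closure 𝓕)) (_ : ν.IsInvInvariant) (_ : ν 𝓕 = 1),
      ∃ (T : ℝ≥0) (_ : 1 ≤ T) (S : Finset ℂ) (_ : ∀ s ∈ S, s.im = 0) (Fam : ℂ → (quasiSplit (↥(maximalRealSubfield L)) L (IsCMField.complexConj L) 3).L2 μ),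
        DifferentiableOn ℂ Fam ({z : ℂ | 1 < z.re} \ (↑(Sp ∪ S) : Set ℂ)) ∧
        ∀ z ∈ ({z : ℂ | 1 < z.re} \ (↑(Sp ∪ S) : Set ℂ)), ((Fam z : (quasiSplit (↥(maximalRealSubfield L)) L (IsCMField.complexConj L) 3).L2 μ) : (quasiSplit (↥(maximalRealSubfield L)) L (IsCMField.complexConj L) 3).automorphicQuotient → ℂ) =ᵐ[μ] (quasiSplit (↥(maximalRealSubfield L)) L (IsCMField.complexConj L) 3).quotFun (truncation ν 𝓕 T (Ec z)) := by
  intro U₀ hU₀ φ hφV hφc hfin Ec Sp hSp hEd hE2 Fp _hF _hFE f _hf ν hν 𝓕 h𝓕N h𝓕c hνi hν1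
  haveI := hν
  obtain ⟨Ec', P, hPc, hPcd, hPre, hE2', hEan', hE4', hEbd', hE6'⟩ := hTEXP6 U₀ hU₀ φ hφV hφc hfin ν hν 𝓕 h𝓕N h𝓕c hνi hν1
  exact hCONT_of_truncatedFamily_exports_free L μ hχ₂ (isChiSectionPair_of_mem hφV) Ec Sp hSp hEd hE2 ν h𝓕N h𝓕c hPc hPcd hPre hEan' hE2' hE4' hEbd' le_rfl (hE6' 1 le_rfl)

/-! ## §4 The exports-with-(E6) τ-row, hence the `hCONT` τ-row, from the BLOCK LETTER (★ p864592 at each block; the row's own Heisenberg package) -/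

/-- **`hTEXP6` AT PURE-TYPE τ-ADMISSIBLE GENERATORS FROM THE BLOCK LETTER** (the frame of ★ `_of_letters_of_eigen_with_truncatedFamily` MINUS its Heisenberg package, which is the row's;
`χ₂` automorphic): if every τ-admissible generator `φ` lies in a finite-dimensional `K_max`-stable block `V` of continuous bounded `(χ₁, χ₂)`-pair-sections carrying row 1's gauge letters AT
`V` (★ p864446's `hBLOCK`, same bytes), then for every normalised Heisenberg package `(ν, 𝓕)` the exports with (E6) hold at `φ` — ★ p864592
`chiEisenstein_meromorphic_exports_kfinite_cm_three_of_gauge_letters_with_truncatedFamily` at `V` with the row's `ν` (right-invariant: Haar and inversion-invariant) and `𝓕` (`ν 𝓕 = 1 ≠ 0`).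
[cite: BernsteinLapid2019, Thm 2.3, §4, §7] [cite: MoeglinWaldspurger1995, II.1.7, IV.1.8–IV.1.11, IV.2.3] -/
theorem truncatedExportsTauRow_of_gauge_blocks
    (μ : Measure (quasiSplit (↥(maximalRealSubfield L)) L (IsCMField.complexConj L) 3).automorphicQuotient) [(quasiSplit (↥(maximalRealSubfield L)) L (IsCMField.complexConj L) 3).IsAutomorphicMeasure μ]
    (νG : Measure (quasiSplit (↥(maximalRealSubfield L)) L (IsCMField.complexConj L) 3).Adelic) [νG.IsHaarMeasure] [νG.IsInvInvariant] [SFinite νG]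
    {β : (quasiSplit (↥(maximalRealSubfield L)) L (IsCMField.complexConj L) 3).Adelic → ℝ≥0∞}
    (hβ : IsCoveringWeight ↥((arithmeticBorel (↥(maximalRealSubfield L)) L (IsCMField.complexConj L) 3).map (quasiSplit (↥(maximalRealSubfield L)) L (IsCMField.complexConj L) 3).arithmeticSubgroup.subtype) β)
    {μZ : Measure (borelQuotient (↥(maximalRealSubfield L)) L (IsCMField.complexConj L) 3)} [SFinite μZ]
    (hμZ : ∀ f : borelQuotient (↥(maximalRealSubfield L)) L (IsCMField.complexConj L) 3 → ℝ≥0∞, Measurable f → ∫⁻ z, f z ∂μZ = ∫⁻ g, β g * f (toBorelQuotient (↥(maximalRealSubfield L)) L (IsCMField.complexConj L) 3 g) ∂νG)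
    {χ₁ : HeckeCharacter L} {χ₂ : ↥(TorusDict.torus (IsCMField.complexConj L)) →ₜ* ℂˣ} (hχ₂ : TorusDict.IsAutomorphic (IsCMField.complexConj L) χ₂)
    (hBLOCK : ∀ (U₀ : Subgroup ↥(finAdelic (↥(maximalRealSubfield L)) L (IsCMField.complexConj L) 3 ((StdForm.antidiagonal 3).over L))) (_ : IsTauLevel L U₀)
      (φ : (quasiSplit (↥(maximalRealSubfield L)) L (IsCMField.complexConj L) 3).Adelic → ℂ) (_ : φ ∈ chiSectionSpacePair χ₁ χ₂ (tauLevel L U₀) ((1 : ↥(tauLevel L U₀) →* ℂ) : ↥(tauLevel L U₀) → ℂ)) (_ : Continuous φ)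
      (_ : IsArchFinite L φ),
      ∃ V : Submodule ℂ ((quasiSplit (↥(maximalRealSubfield L)) L (IsCMField.complexConj L) 3).Adelic → ℂ), FiniteDimensional ℂ ↥V ∧ φ ∈ V ∧
        (∀ k ∈ ((standardMaximalCompactGL 3 L).comap (adelicVal (↥(maximalRealSubfield L)) L (IsCMField.complexConj L) 3 ((StdForm.antidiagonal 3).over L)) : Subgroup (quasiSplit (↥(maximalRealSubfield L)) L (IsCMField.complexConj L) 3).Adelic), ∀ ψ ∈ V, (fun x => ψ (x * k)) ∈ V) ∧
        (∀ ψ ∈ V, IsChiSectionPair χ₁ χ₂ ψ) ∧ (∀ ψ ∈ V, Continuous ψ) ∧ (∀ ψ ∈ V, ∃ M : ℝ, ∀ x, ‖ψ x‖ ≤ M) ∧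
        (∀ z₀ : ℂ, ∃ η : GL (Fin 3) (AdeleRing (𝓞 L) L) → ℝ, IsTestFunctionGL 3 L η ∧ (∀ g, 0 ≤ η g) ∧ (∀ g, η g⁻¹ = η g) ∧
      ∃ s : ℂ → ℂ, Differentiable ℂ s ∧ s z₀ ≠ 0 ∧ ∀ z : ℂ, ∀ φ ∈ V, ∀ x : (quasiSplit (↥(maximalRealSubfield L)) L (IsCMField.complexConj L) 3).Adelic, (∫ y, (fun y : (quasiSplit (↥(maximalRealSubfield L)) L (IsCMField.complexConj L) 3).Adelic => orbitalSmoothing νG (fun x : (quasiSplit (↥(maximalRealSubfield L)) L (IsCMField.complexConj L) 3).Adelic => ((η (adelicVal (↥(maximalRealSubfield L)) L (IsCMField.complexConj L) 3 ((StdForm.antidiagonal 3).over L) x) : ℝ) : ℂ)) (fun x : (quasiSplit (↥(maximalRealSubfield L)) L (IsCMField.complexConj L) 3).Adelic => ((η (adelicVal (↥(maximalRealSubfield L)) L (IsCMField.complexConj L) 3 ((StdForm.antidiagonal 3).over L) x) : ℝ) : ℂ)) y) y * flatSectionU φ z (x * y) ∂νG) = s z * flatSectionU φ z x) ∧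
        (∃ η : GL (Fin 3) (AdeleRing (𝓞 L) L) → ℝ, IsTestFunctionGL 3 L η ∧ (∀ g, 0 ≤ η g) ∧ (∀ g, η g⁻¹ = η g) ∧
      ∃ s : ℂ → ℂ, Differentiable ℂ s ∧ (∃ z₁ z₂ : ℂ, s z₁ ≠ s z₂) ∧ ∀ z : ℂ, ∀ φ ∈ V, ∀ x : (quasiSplit (↥(maximalRealSubfield L)) L (IsCMField.complexConj L) 3).Adelic, (∫ y, (fun y : (quasiSplit (↥(maximalRealSubfield L)) L (IsCMField.complexConj L) 3).Adelic => orbitalSmoothing νG (fun x : (quasiSplit (↥(maximalRealSubfield L)) L (IsCMField.complexConj L) 3).Adelic => ((η (adelicVal (↥(maximalRealSubfield L)) L (IsCMField.complexConj L) 3 ((StdForm.antidiagonal 3).over L) x) : ℝ) : ℂ)) (fun x : (quasiSplit (↥(maximalRealSubfield L)) L (IsCMField.complexConj L) 3).Adelic => ((η (adelicVal (↥(maximalRealSubfield L)) L (IsCMField.complexConj L) 3 ((StdForm.antidiagonal 3).over L) x) : ℝ) : ℂ)) y) y * flatSectionU φ z (x * y) ∂νG) = s z * flatSectionU φ z x))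 :
    ∀ (U₀ : Subgroup ↥(finAdelic (↥(maximalRealSubfield L)) L (IsCMField.complexConj L) 3 ((StdForm.antidiagonal 3).over L))) (_ : IsTauLevel L U₀)
      (φ : (quasiSplit (↥(maximalRealSubfield L)) L (IsCMField.complexConj L) 3).Adelic → ℂ) (_ : φ ∈ chiSectionSpacePair χ₁ χ₂ (tauLevel L U₀) ((1 : ↥(tauLevel L U₀) →* ℂ) : ↥(tauLevel L U₀) → ℂ)) (_ : Continuous φ)
      (_ : IsArchFinite L φ)
      (ν : Measure ↥(adelicUnipotent (↥(maximalRealSubfield L)) L (IsCMField.complexConj L) 3)) (_ : ν.IsHaarMeasure) (𝓕 : Set ↥(adelicUnipotent (↥(maximalRealSubfield L)) L (IsCMField.complexConj L) 3))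
      (_ : IsFundamentalDomain ↥(rationalUnipotent (↥(maximalRealSubfield L)) L (IsCMField.complexConj L) 3) 𝓕 ν) (_ : IsCompact (closure 𝓕)) (_ : ν.IsInvInvariant) (_ : ν 𝓕 = 1),
      ∃ (Ec' : ℂ → (quasiSplit (↥(maximalRealSubfield L)) L (IsCMField.complexConj L) 3).Adelic → ℂ) (P : Set ℂ), IsClosed P ∧ (∀ z₀ : ℂ, ∀ᶠ s in 𝓝[≠] z₀, s ∉ P) ∧ (∀ z ∈ P, z.re ≤ 2) ∧
        (∀ z : ℂ, 2 < z.re → Ec' z = eisensteinSeriesU (flatSectionU φ z)) ∧ (∀ g (z : ℂ), z ∉ P → AnalyticAt ℂ (fun z => Ec' z g) z) ∧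
        (∀ z : ℂ, z ∉ P → Continuous (Ec' z)) ∧
        (∀ z₁ : ℂ, z₁ ∉ P → ∀ K : Set (quasiSplit (↥(maximalRealSubfield L)) L (IsCMField.complexConj L) 3).Adelic, IsCompact K → ∃ V ∈ 𝓝 z₁, ∃ M : ℝ, ∀ z ∈ V, ∀ g ∈ K, ‖Ec' z g‖ ≤ M) ∧
        (∀ T : ℝ≥0, 1 ≤ T → ∃ Fam : ℂ → Lp ℂ 2 μ, DifferentiableOn ℂ Fam Pᶜ ∧
          ∀ z : ℂ, z ∉ P → ((Fam z : Lp ℂ 2 μ) : (quasiSplit (↥(maximalRealSubfield L)) L (IsCMField.complexConj L) 3).automorphicQuotient → ℂ) =ᵐ[μ] (quasiSplit (↥(maximalRealSubfield L)) L (IsCMField.complexConj L) 3).quotFun (truncation ν 𝓕 T (Ec' z))) := by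
  intro U₀ hU₀ φ hφV hφc hfin ν hν 𝓕 h𝓕N h𝓕c hνi hν1
  haveI := hν
  haveI := hνi
  haveI : ν.IsMulRightInvariant := by rw [← Measure.inv_eq_self ν]; infer_instance
  obtain ⟨V, hVfd, hφ, hVK, hVχ, hVc, hVM, hfam, hnc⟩ := hBLOCK U₀ hU₀ φ hφV hφc hfin
  haveI := hVfd
  obtain ⟨n, φ', q, Ec, qc, P, -, -, -, -, -, -, -, -, hEcE, -, hPc, hPcd, hPre, hEan, -, -, -, hEcont, hEbd, hE6⟩ :=
    chiEisenstein_meromorphic_exports_kfinite_cm_three_of_gauge_letters_with_truncatedFamily L μ νG ν h𝓕N h𝓕c (by rw [hν1]; exact one_ne_zero) hβ hμZ hχ₂ V hVK hVχ hVc hVM hfam hnc hφ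
  exact ⟨Ec, P, hPc, hPcd, hPre, hEcE, hEan, hEcont, hEbd, hE6⟩

/-- **THE `hCONT` τ-ROW FROM THE BLOCK LETTER** (§3 ∘ §4): at the exports' frame minus its Heisenberg package, for `χ₂` automorphic, ★ p864188's `hCONT` ∀-row holds as soon as every
τ-admissible generator lies in a finite-dimensional `K_max`-stable block of continuous bounded pair-sections carrying the gauge letters — the (R)′ `hCONT` row «★ modulo the τ-ports (★)
and K2E1-p12's laws at named blocks», with NO ledger and NO Maass–Selberg letter; the same `hBLOCK` pays ★ p864446's `hEXP` row.
[cite: MoeglinWaldspurger1995, IV.1.11, IV.2.3, V.3.13] [cite: BernsteinLapid2019, Thm 2.3, §4, §7] [cite: Rogawski1990, §13.9 p. 229 (ii)] -/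
theorem hCONT_tauRow_of_gauge_blocks
    (μ : Measure (quasiSplit (↥(maximalRealSubfield L)) L (IsCMField.complexConj L) 3).automorphicQuotient) [(quasiSplit (↥(maximalRealSubfield L)) L (IsCMField.complexConj L) 3).IsAutomorphicMeasure μ]
    (νG : Measure (quasiSplit (↥(maximalRealSubfield L)) L (IsCMField.complexConj L) 3).Adelic) [νG.IsHaarMeasure] [νG.IsInvInvariant] [SFinite νG]
    {β : (quasiSplit (↥(maximalRealSubfield L)) L (IsCMField.complexConj L) 3).Adelic → ℝ≥0∞}
    (hβ : IsCoveringWeight ↥((arithmeticBorel (↥(maximalRealSubfield L)) L (IsCMField.complexConj L) 3).map (quasiSplit (↥(maximalRealSubfield L)) L (IsCMField.complexConj L) 3).arithmeticSubgroup.subtype) β)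
    {μZ : Measure (borelQuotient (↥(maximalRealSubfield L)) L (IsCMField.complexConj L) 3)} [SFinite μZ]
    (hμZ : ∀ f : borelQuotient (↥(maximalRealSubfield L)) L (IsCMField.complexConj L) 3 → ℝ≥0∞, Measurable f → ∫⁻ z, f z ∂μZ = ∫⁻ g, β g * f (toBorelQuotient (↥(maximalRealSubfield L)) L (IsCMField.complexConj L) 3 g) ∂νG)
    {χ₁ : HeckeCharacter L} {χ₂ : ↥(TorusDict.torus (IsCMField.complexConj L)) →ₜ* ℂˣ} (hχ₂ : TorusDict.IsAutomorphic (IsCMField.complexConj L) χ₂)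
    (hBLOCK : ∀ (U₀ : Subgroup ↥(finAdelic (↥(maximalRealSubfield L)) L (IsCMField.complexConj L) 3 ((StdForm.antidiagonal 3).over L))) (_ : IsTauLevel L U₀)
      (φ : (quasiSplit (↥(maximalRealSubfield L)) L (IsCMField.complexConj L) 3).Adelic → ℂ) (_ : φ ∈ chiSectionSpacePair χ₁ χ₂ (tauLevel L U₀) ((1 : ↥(tauLevel L U₀) →* ℂ) : ↥(tauLevel L U₀) → ℂ)) (_ : Continuous φ)
      (_ : IsArchFinite L φ),
      ∃ V : Submodule ℂ ((quasiSplit (↥(maximalRealSubfield L)) L (IsCMField.complexConj L) 3).Adelic → ℂ), FiniteDimensional ℂ ↥V ∧ φ ∈ V ∧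
        (∀ k ∈ ((standardMaximalCompactGL 3 L).comap (adelicVal (↥(maximalRealSubfield L)) L (IsCMField.complexConj L) 3 ((StdForm.antidiagonal 3).over L)) : Subgroup (quasiSplit (↥(maximalRealSubfield L)) L (IsCMField.complexConj L) 3).Adelic), ∀ ψ ∈ V, (fun x => ψ (x * k)) ∈ V) ∧
        (∀ ψ ∈ V, IsChiSectionPair χ₁ χ₂ ψ) ∧ (∀ ψ ∈ V, Continuous ψ) ∧ (∀ ψ ∈ V, ∃ M : ℝ, ∀ x, ‖ψ x‖ ≤ M) ∧
        (∀ z₀ : ℂ, ∃ η : GL (Fin 3) (AdeleRing (𝓞 L) L) → ℝ, IsTestFunctionGL 3 L η ∧ (∀ g, 0 ≤ η g) ∧ (∀ g, η g⁻¹ = η g) ∧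
      ∃ s : ℂ → ℂ, Differentiable ℂ s ∧ s z₀ ≠ 0 ∧ ∀ z : ℂ, ∀ φ ∈ V, ∀ x : (quasiSplit (↥(maximalRealSubfield L)) L (IsCMField.complexConj L) 3).Adelic, (∫ y, (fun y : (quasiSplit (↥(maximalRealSubfield L)) L (IsCMField.complexConj L) 3).Adelic => orbitalSmoothing νG (fun x : (quasiSplit (↥(maximalRealSubfield L)) L (IsCMField.complexConj L) 3).Adelic => ((η (adelicVal (↥(maximalRealSubfield L)) L (IsCMField.complexConj L) 3 ((StdForm.antidiagonal 3).over L) x) : ℝ) : ℂ)) (fun x : (quasiSplit (↥(maximalRealSubfield L)) L (IsCMField.complexConj L) 3).Adelic => ((η (adelicVal (↥(maximalRealSubfield L)) L (IsCMField.complexConj L) 3 ((StdForm.antidiagonal 3).over L) x) : ℝ) : ℂ)) y) y * flatSectionU φ z (x * y) ∂νG) = s z * flatSectionU φ z x) ∧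
        (∃ η : GL (Fin 3) (AdeleRing (𝓞 L) L) → ℝ, IsTestFunctionGL 3 L η ∧ (∀ g, 0 ≤ η g) ∧ (∀ g, η g⁻¹ = η g) ∧
      ∃ s : ℂ → ℂ, Differentiable ℂ s ∧ (∃ z₁ z₂ : ℂ, s z₁ ≠ s z₂) ∧ ∀ z : ℂ, ∀ φ ∈ V, ∀ x : (quasiSplit (↥(maximalRealSubfield L)) L (IsCMField.complexConj L) 3).Adelic, (∫ y, (fun y : (quasiSplit (↥(maximalRealSubfield L)) L (IsCMField.complexConj L) 3).Adelic => orbitalSmoothing νG (fun x : (quasiSplit (↥(maximalRealSubfield L)) L (IsCMField.complexConj L) 3).Adelic => ((η (adelicVal (↥(maximalRealSubfield L)) L (IsCMField.complexConj L) 3 ((StdForm.antidiagonal 3).over L) x) : ℝ) : ℂ)) (fun x : (quasiSplit (↥(maximalRealSubfield L)) L (IsCMField.complexConj L) 3).Adelic => ((η (adelicVal (↥(maximalRealSubfield L)) L (IsCMField.complexConj L) 3 ((StdForm.antidiagonal 3).over L) x) : ℝ) : ℂ)) y) y * flatSectionU φ z (x * y) ∂νG) = s z * flatSectionU φ z x))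 :
    ∀ (U₀ : Subgroup ↥(finAdelic (↥(maximalRealSubfield L)) L (IsCMField.complexConj L) 3 ((StdForm.antidiagonal 3).over L))) (_ : IsTauLevel L U₀)
      (φ : (quasiSplit (↥(maximalRealSubfield L)) L (IsCMField.complexConj L) 3).Adelic → ℂ) (_ : φ ∈ chiSectionSpacePair χ₁ χ₂ (tauLevel L U₀) ((1 : ↥(tauLevel L U₀) →* ℂ) : ↥(tauLevel L U₀) → ℂ)) (_ : Continuous φ)
      (_ : IsArchFinite L φ)
      (Ec : ℂ → (quasiSplit (↥(maximalRealSubfield L)) L (IsCMField.complexConj L) 3).Adelic → ℂ) (Sp : Finset ℂ) (_ : ∀ s ∈ Sp, s.im = 0 ∧ 1 < s.re ∧ s.re ≤ 2)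
      (_ : ∀ g, DifferentiableOn ℂ (fun z => Ec z g) ({z : ℂ | 1 < z.re} \ (↑Sp : Set ℂ)))
      (_ : ∀ z : ℂ, 2 < z.re → Ec z = eisensteinSeriesU (flatSectionU φ z))
      (Fp : (quasiSplit (↥(maximalRealSubfield L)) L (IsCMField.complexConj L) 3).Adelic → ℂ → ℂ) (_ : ∀ g, AnalyticAt ℂ (Fp g) ((3 : ℂ) / 2))
      (_ : ∀ g, Fp g =ᶠ[𝓝[≠] ((3 : ℂ) / 2)] fun z => (z - (3 : ℂ) / 2) * Ec z g)
      (f : (quasiSplit (↥(maximalRealSubfield L)) L (IsCMField.complexConj L) 3).L2 μ) (_ : (f : (quasiSplit (↥(maximalRealSubfield L)) L (IsCMField.complexConj L) 3).automorphicQuotient → ℂ) =ᵐ[μ] fun x => Fp (Quotient.out (x : (quasiSplit (↥(maximalRealSubfield L)) L (IsCMField.complexConj L) 3).Adelic ⧸ (quasiSplit (↥(maximalRealSubfield L)) L (IsCMField.complexConj L) 3).quotientSubgroup))⁻¹ ((3 : ℂ) / 2))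
      (ν : Measure ↥(adelicUnipotent (↥(maximalRealSubfield L)) L (IsCMField.complexConj L) 3)) (_ : ν.IsHaarMeasure) (𝓕 : Set ↥(adelicUnipotent (↥(maximalRealSubfield L)) L (IsCMField.complexConj L) 3)) (_ : IsFundamentalDomain ↥(rationalUnipotent (↥(maximalRealSubfield L)) L (IsCMField.complexConj L) 3) 𝓕 ν) (_ : IsCompact (closure 𝓕)) (_ : ν.IsInvInvariant) (_ : ν 𝓕 = 1),
      ∃ (T : ℝ≥0) (_ : 1 ≤ T) (S : Finset ℂ) (_ : ∀ s ∈ S, s.im = 0) (Fam : ℂ → (quasiSplit (↥(maximalRealSubfield L)) L (IsCMField.complexConj L) 3).L2 μ),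
        DifferentiableOn ℂ Fam ({z : ℂ | 1 < z.re} \ (↑(Sp ∪ S) : Set ℂ)) ∧
        ∀ z ∈ ({z : ℂ | 1 < z.re} \ (↑(Sp ∪ S) : Set ℂ)), ((Fam z : (quasiSplit (↥(maximalRealSubfield L)) L (IsCMField.complexConj L) 3).L2 μ) : (quasiSplit (↥(maximalRealSubfield L)) L (IsCMField.complexConj L) 3).automorphicQuotient → ℂ) =ᵐ[μ] (quasiSplit (↥(maximalRealSubfield L)) L (IsCMField.complexConj L) 3).quotFun (truncation ν 𝓕 T (Ec z)) :=
  hCONT_tauRow_of_truncatedExportsRow L μ hχ₂ (truncatedExportsTauRow_of_gauge_blocks L μ νG hβ hμZ hχ₂ hBLOCK)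

end Summit.HodgeConjecture.HodgeConjecture.R90.S8

end
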